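import Mathlib
import Summits.MatrixMultiplication.MatrixMultiplication.Theses.FourierTwoFamiliesModP
import Summits.MatrixMultiplication.MatrixMultiplication.Theorems.PrimeTwoFamilies.Negative.Slices
import Summits.MatrixMultiplication.MatrixMultiplication.Theorems.FourierTwoFamiliesModPCyclicReductionTransfer
import Summits.MatrixMultiplication.MatrixMultiplication.Theorems.FourierTwoFamiliesModPPrimeTwoFamiliesCapacityLift
import Summits.MatrixMultiplication.MatrixMultiplication.Theorems.FourierTwoFamiliesModPPrimeTwoFamiliesStubCapBookkeeping
import Summits.MatrixMultiplication.MatrixMultiplication.Theorems.FourierTwoFamiliesModPPrimeTwoFamiliesLadderConverse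
import Literature.Computability.AlgebraicComplexity.SimultaneousDoubleProduct

/-!
# Self-converse gadgets `↔ PrimeTwoFamilies`, through two finite certificates (support file)

Item `stmt-MatrixMultiplication-14308` (`FourierTwoFamiliesModP.PrimeTwoFamilies`, CKSU 2005 Conj. 4.7 with
prime cyclic hosts), line `Sketch` (capacity-gadget form), registered stub
`selfConverseGadgets_iff_primeTwoFamilies` — siege attempt k20, variation "certificate on the finite core".

A *self-converse gadget* at level `m` is a list of direct pairs `(P c, Q c)_{c<r}` in `ℤ/m` (direct:
`(x - x') + (y - y') = 0` inside one pair forces `x = x'`, `y = y'`; letters may coincide) with a map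
`π : Fin r → Fin r` such that every ORDERED pair of distinct letters `σ ≠ τ` is *strongly separated* —
every cross difference `q - p` (`p ∈ P σ`, `q ∈ Q τ`) avoids every diagonal difference `q' - p'`
(`p' ∈ P c`, `q' ∈ Q c`) — either directly or after applying `π`.  The stub says: gadgets with
`r ≥ m^{1-ε}` letters of co-volume `|P c||Q c| ≥ m^{1-ε}` for every `ε > 0` and arbitrarily large `m`
exist **iff** the crux `PrimeTwoFamilies` holds.

Organisation of this proof.  All the combinatorics is concentrated in two FINITE, level-wise
certificates with explicit constants and no real exponents:

* `exists_prime_sdpp_of_gadget` (forward certificate): a gadget of `r` letters in `ℤ/m` (`m ≥ 1`) yields a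
  prime `p ≤ 18 m²` and `r` pairs `(A σ, B σ)` in `ℤ/p` satisfying the two SDPP clauses (W), (X) verbatim,
  with `|A σ| = |P σ||P (π σ)|`, `|B σ| = |Q σ||Q (π σ)|`.  It is the product family
  `(P σ ×ˢ P (π σ), Q σ ×ˢ Q (π σ))` in `(ℤ/m)²` (tree `CapacityLift.selfConverseLift`, the `L = 2` graph
  code) moved into a prime cyclic host by the carry-free lift (tree `exists_prime_sdpp_of_addEquiv`,
  `k = 2` factors, `(ℤ/m)² ≃+ (Fin 2 → ℤ/m)` by `LinearEquiv.finTwoArrow`).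
* `gadget_of_sdpp` (backward certificate, any abelian group): an SDPP family `(A i, B i)_{i<n}` yields a
  self-converse gadget on `n·n` letters — letter `(i, i')` REPEATS the pair `(A i, B i)` and `π` is the
  coordinate SWAP `(i, i') ↦ (i', i)` (an involution): two distinct letters differ in the first coordinate
  (clause (X) separates them directly, `cross_separated_of_sdpp`) or in the second (clause (X) separates
  their swaps).

The asymptotic statement is then a thin shell of exponent bookkeeping around the certificates, reusing
the tree's `CapacityLift.stub_capBookkeeping` (at word length `L = 2`), `LadderLift.ladder_exponents` and
the slice calculus `Negative.primeTwoFamilies_iff` / `PrimeTwoFamiliesAt.mono`.  An independent second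
proof of the equivalence first landed as `CapacityLift.selfConverseGadgets_iff_primeTwoFamilies`
(through capacity gadgets of arbitrary word length); here no word code of length `L > 2` appears.
-/

-- single-conjunct summit: the mandated namespace repeats `MatrixMultiplication` (summit = sub-problem).
set_option linter.dupNamespace false

namespace Summit.MatrixMultiplication.MatrixMultiplication.Theorems.PrimeTwoFamilies.SelfConverseCertificate

open Finset
open Summit.MatrixMultiplication.MatrixMultiplication.Theses
open Summit.MatrixMultiplication.MatrixMultiplication.Theorems
open Literature.Computability.AlgebraicComplexity

/-! ## §1 Backward certificate: letter repetition with the coordinate swap -/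

/-- Clause (X) of the SDPP, read as strong separation: for distinct indices `i ≠ k` every cross
difference `y - x` (`x ∈ A i`, `y ∈ B k`) avoids every diagonal difference `y' - x'` (`x' ∈ A j`,
`y' ∈ B j`) — apply (X) at the index triple `(i, j, k)`. -/
theorem cross_separated_of_sdpp {K : Type*} [AddCommGroup K] {n : ℕ} {A B : Fin n → Finset K}
    (hX : ∀ i j k : Fin n, ∀ a ∈ A i, ∀ a' ∈ A j, ∀ b ∈ B j, ∀ b' ∈ B k,
      (a - a') + (b - b') = 0 → i = k) :
    ∀ i k : Fin n, i ≠ k → ∀ x ∈ A i, ∀ y ∈ B k, ∀ j : Fin n, ∀ x' ∈ A j, ∀ y' ∈ B j,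
      y - x ≠ y' - x' := by
  intro i k hik x hx y hy j x' hx' y' hy' heq
  have h0 : (x - x') + (y' - y) = 0 := by
    rw [show (x - x') + (y' - y) = (y' - x') - (y - x) by abel, heq, sub_self]
  exact hik (hX i j k x hx x' hx' y' hy' y hy h0)

/-- **Backward certificate (letter repetition, swap involution).**  From an SDPP family
`(A i, B i)_{i<n}` in any abelian group — (W) every pair direct, (X) `(a - a') + (b - b') = 0` with
`a ∈ A i`, `a' ∈ A j`, `b ∈ B j`, `b' ∈ B k` forces `i = k` — one gets a self-converse gadget on `n * n`
letters: an index map `ι : Fin (n*n) → Fin n` (first coordinate under `Fin (n*n) ≃ Fin n × Fin n`), so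
that letter `c` carries the pair `(A (ι c), B (ι c))`, and the swap `π` of the two coordinates, such that
every letter is direct and every ordered pair of distinct letters is strongly separated directly or after
`π`.  Distinct letters differ in the first coordinate — then (X) separates them
(`cross_separated_of_sdpp`) — or in the second, and then their swaps differ in the first coordinate. -/
theorem gadget_of_sdpp {K : Type*} [AddCommGroup K] {n : ℕ} (A B : Fin n → Finset K)
    (hW : ∀ i : Fin n, ∀ a ∈ A i, ∀ a' ∈ A i, ∀ b ∈ B i, ∀ b' ∈ B i,
      (a - a') + (b - b') = 0 → a = a' ∧ b = b')
    (hX : ∀ i j k : Fin n, ∀ a ∈ A i, ∀ a' ∈ A j, ∀ b ∈ B j, ∀ b' ∈ B k,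
      (a - a') + (b - b') = 0 → i = k) :
    ∃ (ι : Fin (n * n) → Fin n) (π : Fin (n * n) → Fin (n * n)),
      (∀ c : Fin (n * n), ∀ x ∈ A (ι c), ∀ x' ∈ A (ι c), ∀ y ∈ B (ι c), ∀ y' ∈ B (ι c),
          (x - x') + (y - y') = 0 → x = x' ∧ y = y') ∧
      (∀ σ τ : Fin (n * n), σ ≠ τ →
        (∀ p ∈ A (ι σ), ∀ q ∈ B (ι τ), ∀ c : Fin (n * n), ∀ p' ∈ A (ι c), ∀ q' ∈ B (ι c),
            q - p ≠ q' - p') ∨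
        (∀ p ∈ A (ι (π σ)), ∀ q ∈ B (ι (π τ)), ∀ c : Fin (n * n), ∀ p' ∈ A (ι c), ∀ q' ∈ B (ι c),
            q - p ≠ q' - p')) := by
  have hsep := cross_separated_of_sdpp hX
  -- letters `Fin (n*n) ≃ Fin n × Fin n`; `ι` = first coordinate, `π` = swap of the coordinates
  set e : Fin (n * n) ≃ Fin n × Fin n := finProdFinEquiv.symm with he
  refine ⟨fun c => (e c).1, fun c => e.symm (e c).swap, fun c => hW (e c).1, ?_⟩
  intro σ τ hστ
  by_cases h1 : (e σ).1 = (e τ).1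
  · -- same first coordinate: the second coordinates differ, and they lead the swapped letters
    right
    have h2 : (e σ).2 ≠ (e τ).2 := fun h2 => hστ (e.injective (Prod.ext h1 h2))
    intro x hx y hy c x' hx' y' hy'
    simp only [Equiv.apply_symm_apply, Prod.fst_swap] at hx hy
    exact hsep _ _ h2 x hx y hy _ x' hx' y' hy'
  · -- distinct first coordinates: separated directly
    left
    intro x hx y hy c x' hx' y' hy'
    exact hsep _ _ h1 x hx y hy _ x' hx' y' hy'

/-! ## §2 Forward certificate: the squared gadget in a prime cyclic host -/

/-- **Forward certificate (level-wise, explicit constant `18`).**  A self-converse gadget of `r` direct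
letters `(P c, Q c)` in `ℤ/m`, `m ≥ 1`, with separating map `π`, yields a prime `p ≤ 2·3²·m²` and `r`
pairs `(A σ, B σ)` in `ℤ/p` satisfying the SDPP clauses (W) and (X) verbatim, of sizes
`|A σ| = |P σ||P (π σ)|`, `|B σ| = |Q σ||Q (π σ)|`.  Construction: the product blocks
`(P σ ×ˢ P (π σ), Q σ ×ˢ Q (π σ))` in `(ℤ/m)²` are SDPP (`CapacityLift.selfConverseLift`); the carry-free
lift `exists_prime_sdpp_of_addEquiv` along `(ℤ/m)² ≃+ (Fin 2 → ℤ/m)` moves them, sizes and clauses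
intact, into `ℤ/p` for a Bertrand prime `p ≤ 2·3²·m²`. -/
theorem exists_prime_sdpp_of_gadget {m : ℕ} (hm : 1 ≤ m) {r : ℕ} (P Q : Fin r → Finset (ZMod m))
    (π : Fin r → Fin r)
    (hD : ∀ c : Fin r, ∀ x ∈ P c, ∀ x' ∈ P c, ∀ y ∈ Q c, ∀ y' ∈ Q c,
      (x - x') + (y - y') = 0 → x = x' ∧ y = y')
    (hS : ∀ σ τ : Fin r, σ ≠ τ →
      (∀ p ∈ P σ, ∀ q ∈ Q τ, ∀ c : Fin r, ∀ p' ∈ P c, ∀ q' ∈ Q c, q - p ≠ q' - p') ∨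
      (∀ p ∈ P (π σ), ∀ q ∈ Q (π τ), ∀ c : Fin r, ∀ p' ∈ P c, ∀ q' ∈ Q c, q - p ≠ q' - p')) :
    ∃ p : ℕ, p.Prime ∧ p ≤ 2 * (3 ^ 2 * m ^ 2) ∧
      ∃ A B : Fin r → Finset (ZMod p),
        (∀ σ : Fin r, (A σ).card = (P σ).card * (P (π σ)).card ∧
          (B σ).card = (Q σ).card * (Q (π σ)).card) ∧
        (∀ i : Fin r, ∀ a ∈ A i, ∀ a' ∈ A i, ∀ b ∈ B i, ∀ b' ∈ B i,
          (a - a') + (b - b') = 0 → a = a' ∧ b = b') ∧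
        (∀ i j k : Fin r, ∀ a ∈ A i, ∀ a' ∈ A j, ∀ b ∈ B j, ∀ b' ∈ B k,
          (a - a') + (b - b') = 0 → i = k) := by
  classical
  -- the squared gadget in `(ℤ/m)²` is an honest SDPP family (tree: the `L = 2` graph code)
  obtain ⟨hW, hX⟩ := CapacityLift.selfConverseLift P Q hD π hS
  -- move it into a prime cyclic host (tree: carry-free lift, `k = 2` cyclic factors `ℤ/m`)
  obtain ⟨p, hp, hpR, A, B, hcard, hW', hX'⟩ :=
    exists_prime_sdpp_of_addEquiv (A := fun σ => P σ ×ˢ P (π σ)) (B := fun σ => Q σ ×ˢ Q (π σ))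
      hW hX (m := fun _ : Fin 2 => m) (fun _ => hm)
      (LinearEquiv.finTwoArrow ℤ (ZMod m)).symm.toAddEquiv
  rw [Fin.prod_const] at hpR
  refine ⟨p, hp, hpR, A, B, fun σ => ?_, hW', hX'⟩
  obtain ⟨h1, h2⟩ := hcard σ
  rw [h1, h2, Finset.card_product, Finset.card_product]
  exact ⟨rfl, rfl⟩

/-! ## §3 The shell: exponent bookkeeping around the two certificates -/

/-- **Self-converse gadgets give every slice `0 < δ ≤ 1` of the crux.**  Fix `ε` and the threshold by
the tree bookkeeping `CapacityLift.stub_capBookkeeping` (used at word length `L = 2`); take a gadget level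
`m ≥ max m₀ 1`; apply the forward certificate `exists_prime_sdpp_of_gadget` (`r` honest pairs in `ℤ/p`,
`p ≤ 18 m²`, co-volumes `(|P σ||Q σ|)(|P (π σ)||Q (π σ)|) ≥ (m^{1-ε})²`); since
`(m²)^{1/2-ε} = m^{1-2ε} ≤ m^{1-ε} ≤ r`, the bookkeeping returns `n` with `n₀ ≤ n ≤ r`, `p ≤ n^{2+δ}`,
`n^{2-δ} ≤ (m^{1-ε})²`; keep the first `n` pairs. -/
theorem primeTwoFamiliesAt_of_selfConverseGadgets
    (h : ∀ ε : ℝ, 0 < ε → ∀ m₀ : ℕ, ∃ m ≥ m₀, ∃ r : ℕ, ∃ P Q : Fin r → Finset (ZMod m),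
      ∃ π : Fin r → Fin r,
      (∀ c : Fin r, ∀ x ∈ P c, ∀ x' ∈ P c, ∀ y ∈ Q c, ∀ y' ∈ Q c,
          (x - x') + (y - y') = 0 → x = x' ∧ y = y') ∧
      (∀ σ τ : Fin r, σ ≠ τ →
        (∀ p ∈ P σ, ∀ q ∈ Q τ, ∀ c : Fin r, ∀ p' ∈ P c, ∀ q' ∈ Q c, q - p ≠ q' - p') ∨
        (∀ p ∈ P (π σ), ∀ q ∈ Q (π τ), ∀ c : Fin r, ∀ p' ∈ P c, ∀ q' ∈ Q c, q - p ≠ q' - p')) ∧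
      (m : ℝ) ^ (1 - ε) ≤ (r : ℝ) ∧
      ∀ c : Fin r, (m : ℝ) ^ (1 - ε) ≤ (((P c).card * (Q c).card : ℕ) : ℝ))
    {δ : ℝ} (hδ : 0 < δ) (hδ1 : δ ≤ 1) : Negative.PrimeTwoFamiliesAt δ := by
  classical
  intro n₀
  obtain ⟨ε, hε, hbook⟩ := CapacityLift.stub_capBookkeeping δ hδ hδ1
  obtain ⟨m₀, hm₀⟩ := hbook n₀
  obtain ⟨m, hm, r, P, Q, π, hD, hS, hr, hcov⟩ := h ε hε (max m₀ 1)
  have hm₀m : m₀ ≤ m := le_trans (le_max_left _ _) hm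
  have hm1 : 1 ≤ m := le_trans (le_max_right _ _) hm
  have hm1R : (1 : ℝ) ≤ m := by exact_mod_cast hm1
  -- the forward certificate
  obtain ⟨p, hp, hpR, A, B, hcard, hW, hX⟩ := exists_prime_sdpp_of_gadget hm1 P Q π hD hS
  -- the bookkeeping at word length `2`: `(m²)^{1/2-ε} = m^{1-2ε} ≤ m^{1-ε} ≤ r`
  have hN : ((m : ℝ) ^ ((2 : ℕ) : ℝ)) ^ (1 / 2 - ε) ≤ (r : ℝ) := by
    calc ((m : ℝ) ^ ((2 : ℕ) : ℝ)) ^ (1 / 2 - ε)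
        = (m : ℝ) ^ (((2 : ℕ) : ℝ) * (1 / 2 - ε)) := (Real.rpow_mul (by positivity) _ _).symm
      _ = (m : ℝ) ^ (1 - 2 * ε) := by
          congr 1
          push_cast
          ring
      _ ≤ (m : ℝ) ^ (1 - ε) := Real.rpow_le_rpow_of_exponent_le hm1R (by linarith)
      _ ≤ r := hr
  obtain ⟨n, hn₀, hnr, hpn, hnP⟩ := hm₀ m hm₀m 2 (by norm_num) r hN p hpR
  -- keep the first `n` pairs
  refine ⟨n, hn₀, p, hp, A ∘ Fin.castLE hnr, B ∘ Fin.castLE hnr, ?_, ?_, hpn, ?_⟩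
  · intro i
    exact hW (Fin.castLE hnr i)
  · intro i j k a ha a' ha' b hb b' hb' h0
    exact Fin.castLE_injective hnr (hX _ _ _ a ha a' ha' b hb b' hb' h0)
  · intro i
    set σ : Fin r := Fin.castLE hnr i with hσ
    have hci := hcard σ
    simp only [Function.comp_apply]
    rw [← hσ, hci.1, hci.2]
    refine hnP.trans ?_
    have h1 := hcov σ
    have h2 := hcov (π σ)
    have h0 : (0 : ℝ) ≤ (m : ℝ) ^ (1 - ε) := by positivity
    push_cast at h1 h2 ⊢
    calc ((m : ℝ) ^ (1 - ε)) ^ 2 = (m : ℝ) ^ (1 - ε) * (m : ℝ) ^ (1 - ε) := sq _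
      _ ≤ ((P σ).card * (Q σ).card : ℝ) * ((P (π σ)).card * (Q (π σ)).card : ℝ) :=
          mul_le_mul h1 h2 h0 (h0.trans h1)
      _ = ((P σ).card : ℝ) * (P (π σ)).card * ((Q σ).card * (Q (π σ)).card) := by ring

/-- **Self-converse gadgets ↔ `PrimeTwoFamilies`** (registered stub
`selfConverseGadgets_iff_primeTwoFamilies` of line `Sketch`, crux stmt-MatrixMultiplication-14308): for
every `ε > 0` and arbitrarily large `m`, `r ≥ m^{1-ε}` direct pairs in `ℤ/m` of co-volume `≥ m^{1-ε}`
with a map `π` strongly separating every ordered pair of distinct letters directly or after `π` — iff —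
CKSU Conj. 4.7 with prime cyclic hosts.
(⇒) `primeTwoFamiliesAt_of_selfConverseGadgets` on the slices `δ ≤ 1` (forward certificate: square and
transfer) and slice monotonicity above `1`.
(⇐) For `ε > 0` and `m₀` take an SDPP witness `(A i, B i)_{i<n}` in `ℤ/p` of the slice `δ = min ε 1`
with `n ≥ m₀ + 2`; then `m₀ ≤ n ≤ |A i||B i| ≤ p` ((W), `card_mul_card_le_of_dpp`), the backward
certificate `gadget_of_sdpp` gives the gadget on `r = n·n` letters in `ℤ/p` itself (letter repetition
with the swap), and `LadderLift.ladder_exponents` gives `p^{1-ε} ≤ n^{2-δ} ≤ |A i||B i|` and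
`p^{1-ε} ≤ n^{2-δ} ≤ n² = r`. -/
theorem selfConverseGadgets_iff_primeTwoFamilies :
    (∀ ε : ℝ, 0 < ε → ∀ m₀ : ℕ, ∃ m ≥ m₀, ∃ r : ℕ, ∃ P Q : Fin r → Finset (ZMod m),
      ∃ π : Fin r → Fin r,
      (∀ c : Fin r, ∀ x ∈ P c, ∀ x' ∈ P c, ∀ y ∈ Q c, ∀ y' ∈ Q c,
          (x - x') + (y - y') = 0 → x = x' ∧ y = y') ∧
      (∀ σ τ : Fin r, σ ≠ τ →
        (∀ p ∈ P σ, ∀ q ∈ Q τ, ∀ c : Fin r, ∀ p' ∈ P c, ∀ q' ∈ Q c, q - p ≠ q' - p') ∨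
        (∀ p ∈ P (π σ), ∀ q ∈ Q (π τ), ∀ c : Fin r, ∀ p' ∈ P c, ∀ q' ∈ Q c, q - p ≠ q' - p')) ∧
      (m : ℝ) ^ (1 - ε) ≤ (r : ℝ) ∧
      ∀ c : Fin r, (m : ℝ) ^ (1 - ε) ≤ (((P c).card * (Q c).card : ℕ) : ℝ)) ↔
    FourierTwoFamiliesModP.PrimeTwoFamilies := by
  refine ⟨fun h => ?_, fun hT => ?_⟩
  · -- (⇒): every slice `0 < δ ≤ 1` by the forward certificate, larger slices by monotonicity
    rw [Negative.primeTwoFamilies_iff]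
    intro δ hδ
    by_cases h1 : δ ≤ 1
    · exact primeTwoFamiliesAt_of_selfConverseGadgets h hδ h1
    · exact (primeTwoFamiliesAt_of_selfConverseGadgets h one_pos le_rfl).mono (le_of_not_ge h1)
  · -- (⇐): the backward certificate on a witness of the slice `min ε 1`
    intro ε hε m₀
    set δ : ℝ := min ε 1 with hδdef
    have hδ : 0 < δ := lt_min hε one_pos
    have hδε : δ ≤ ε := min_le_left _ _
    have hδ1 : δ ≤ 1 := min_le_right _ _
    obtain ⟨n, hn, p, hp, A, B, hW, hX, hpn, hAB⟩ := hT δ hδ (m₀ + 2)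
    haveI : Fact p.Prime := ⟨hp⟩
    have hn1 : 1 ≤ n := by omega
    have hn1' : (1 : ℝ) ≤ n := by exact_mod_cast hn1
    -- `m₀ ≤ p`, through `m₀ + 2 ≤ n ≤ n^{2-δ} ≤ |A i₀||B i₀| ≤ p`
    have i₀ : Fin n := ⟨0, by omega⟩
    have hABp : (A i₀).card * (B i₀).card ≤ p := by
      have := card_mul_card_le_of_dpp (H := ZMod p) (hW i₀)
      rwa [ZMod.card] at this
    have hm₀ : m₀ ≤ p := by
      have h1 : (n : ℝ) ≤ (n : ℝ) ^ (2 - δ) := by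
        calc (n : ℝ) = (n : ℝ) ^ (1 : ℝ) := (Real.rpow_one _).symm
          _ ≤ (n : ℝ) ^ (2 - δ) := Real.rpow_le_rpow_of_exponent_le hn1' (by linarith)
      have h2 : (n : ℝ) ≤ (p : ℝ) := (h1.trans (hAB i₀)).trans (by exact_mod_cast hABp)
      have h3 : n ≤ p := by exact_mod_cast h2
      omega
    obtain ⟨-, hcovp⟩ := LadderLift.ladder_exponents hδ hδε hδ1 hp.one_lt.le hn1 hpn
    -- the backward certificate
    obtain ⟨ι, π, hD, hS⟩ := gadget_of_sdpp A B hW hX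
    refine ⟨p, hm₀, n * n, fun c => A (ι c), fun c => B (ι c), π, hD, hS, ?_,
      fun c => hcovp.trans (hAB (ι c))⟩
    calc (p : ℝ) ^ (1 - ε) ≤ (n : ℝ) ^ (2 - δ) := hcovp
      _ ≤ (n : ℝ) ^ (2 : ℝ) := Real.rpow_le_rpow_of_exponent_le hn1' (by linarith)
      _ = ((n * n : ℕ) : ℝ) := by rw [Real.rpow_two, sq, Nat.cast_mul]

end Summit.MatrixMultiplication.MatrixMultiplication.Theorems.PrimeTwoFamilies.SelfConverseCertificate
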